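import Summits.HubbardSuperconductivity.HubbardSuperconductivity.Theorems.AnisotropyChordTotalSpinTransfer

/-!
# Route `AnisotropyChord` / H0 rotor rung: RUNG XY-LM_FM — the perturbative XY-Lieb–Mattis statement near the ferromagnetic
# point, typed (port of theory seat `hubbard-h0-rotor-theory-1`, cycle 11, `Sketch11.lean` Part E, memo ROTOR-THEORY-11 §154;
# work-order v11d)

`cgShape S M = (S² − M²)((S−1)² − M²)` and its strict antitonicity in `|M|` (`cgShape_strictAnti`, PROVED); the typed
statements `TotalSpinMonotoneNearFM` (XY-LM on `(1 − η₀, 1]`, paper-proved on regular graphs, Lean-open: work-order v12)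
and `TwoMagnonShapeLaw`; `totalSpinMonotone_of_nearFM_at_one`.  Typing/proof authority: theory seat.
-/

set_option linter.dupNamespace false
set_option autoImplicit false

noncomputable section

open Finset Filter Topology
open Summit.HubbardSuperconductivity.HubbardSuperconductivity.Theorems.AnisotropyChord.InsertionEntropy
open Literature.MathematicalPhysics.QuantumLattice Literature.Probability.LatticeModels

namespace Summit.HubbardSuperconductivity.HubbardSuperconductivity.Theorems.AnisotropyChord.Tower

/-! ## Part E — RUNG XY-LM_FM: the perturbative XY-Lieb–Mattis theorem near the ferromagnetic point (memo §154)

Write `Δ = 1 − η`, `H(η) = H_FM + η·W`, `H_FM = −Σ_{xy} S⃗_x·S⃗_y`, `W = Σ_{xy} SᶻₓSᶻ_y`, `S = |V|/2`, `s₀ = S(S+1)`.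
PAPER THEOREM (§154; regular connected graphs, in particular the torus `Z_L²`): second-order perturbation theory of the
conserved Casimir `S⃗²` + Wigner–Eckart for the rank-2 part of `W` + «regular ⇒ the one-magnon (`S−1`) channel is closed» give
`s₀ − ⟨S⃗²⟩_{ψ_M(η)} = η²·K(G)·F(S,M) + O(η³)`, `F(S,M) = (S² − M²)((S−1)² − M²)` (the squared Clebsch–Gordan coefficient
`⟨S M; 2 0 | S−2 M⟩²` up to an `M`-independent factor), `K(G) > 0` unless `G` is complete.  `F` is strictly decreasing in `|M|`
on `|M| ≤ S − 1`, hence XY-LM holds exactly for `1 − η₀(G) < Δ ≤ 1`.  ED check (kit j309733): on the 4×4 torus at `η = 0.05`,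
`(s₀ − ⟨S⃗²⟩_M)/(η² F(S,M)) = 1.674e-3 … 1.692e-3` for all `M` (1 % spread = the `O(η³)` term); 5×4: `1.62e-3 … 1.68e-3`. -/
section NearFM

/-- The two-magnon Clebsch–Gordan shape `F(S,M) = (S² − M²)((S−1)² − M²)`. -/
def cgShape (S M : ℝ) : ℝ := (S ^ 2 - M ^ 2) * ((S - 1) ^ 2 - M ^ 2)

/-- Real-analysis core of the rung: `F(S,·)` is strictly decreasing in `|M|` on `|M| ≤ S − 1`. -/
theorem cgShape_strictAnti (S M M' : ℝ) (hM : 0 ≤ |M|) (hMM' : |M| < |M'|) (hM' : |M'| ≤ S - 1) :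
    cgShape S M' < cgShape S M := by
  unfold cgShape
  have h1 : M ^ 2 < M' ^ 2 := by
    rw [← sq_abs M, ← sq_abs M']
    exact pow_lt_pow_left₀ hMM' hM (by norm_num)
  have h2 : M' ^ 2 ≤ (S - 1) ^ 2 := by
    rw [← sq_abs M']
    exact pow_le_pow_left₀ (abs_nonneg _) hM' 2
  have hS : 1 ≤ S := by linarith [abs_nonneg M']
  have h3 : (S - 1) ^ 2 ≤ S ^ 2 := by nlinarith
  -- both factors are nonnegative at M' and strictly larger at M
  have hA' : 0 ≤ S ^ 2 - M' ^ 2 := by linarith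
  have hB' : 0 ≤ (S - 1) ^ 2 - M' ^ 2 := by linarith
  nlinarith

/-- **RUNG XY-LM_FM (typed; paper proof memo §154; OPEN in Lean):** on every torus `Z_L²` there is `η₀ > 0` such that
XY-LM (`|M| ≤ |M'| ⇒ ⟨S⃗²⟩_{ψ_M} ≤ ⟨S⃗²⟩_{ψ_{M'}}`) holds for all `1 − η₀ < Δ ≤ 1`.
[conjecture: theory seat hubbard-h0-rotor-theory-1, cycle 11 — perturbative XY-Lieb–Mattis; paper-proved, Lean-open] -/
def TotalSpinMonotoneNearFM : Prop :=
  ∀ (L : ℕ) [NeZero L], ∃ η₀ : ℝ, 0 < η₀ ∧ ∀ Δ : ℝ, 1 - η₀ < Δ → Δ ≤ 1 →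
    ∀ (M M' : ℝ) (a a' : TensorIndex (TorusSite 2 L) 2 → ℝ),
      IsPerronSectorGroundAmplitude L Δ M a → IsPerronSectorGroundAmplitude L Δ M' a' → |M| ≤ |M'| →
        totalSpinSq a M ≤ totalSpinSq a' M'

/-- **TWO-MAGNON SHAPE LAW (typed; paper-proved to second order, memo §154):** with `S = |V|/2`,
`|S(S+1) − ⟨S⃗²⟩_{ψ_M} − (1−Δ)²·K·F(S,M)| ≤ C(1−Δ)³` for `0 ≤ 1 − Δ ≤ η₁`, some `K > 0`, `C`, `η₁ > 0` depending on `L`.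
[conjecture: theory seat hubbard-h0-rotor-theory-1, cycle 11 — quantitative form of XY-LM_FM; paper-proved, Lean-open] -/
def TwoMagnonShapeLaw : Prop :=
  ∀ (L : ℕ) [NeZero L], 2 ≤ L → ∃ K C η₁ : ℝ, 0 < K ∧ 0 < η₁ ∧ ∀ Δ : ℝ, 1 - η₁ ≤ Δ → Δ ≤ 1 →
    ∀ (M : ℝ) (a : TensorIndex (TorusSite 2 L) 2 → ℝ), IsPerronSectorGroundAmplitude L Δ M a →
      |(Fintype.card (TorusSite 2 L) : ℝ) / 2 * ((Fintype.card (TorusSite 2 L) : ℝ) / 2 + 1) - totalSpinSq a M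
          - (1 - Δ) ^ 2 * K * cgShape ((Fintype.card (TorusSite 2 L) : ℝ) / 2) M| ≤ C * (1 - Δ) ^ 3

/-- The near-FM statement specialised to `Δ = 1`. [folklore] -/
theorem totalSpinMonotone_of_nearFM_at_one (h : TotalSpinMonotoneNearFM) (L : ℕ) [NeZero L]
    (M M' : ℝ) (a a' : TensorIndex (TorusSite 2 L) 2 → ℝ)
    (ha : IsPerronSectorGroundAmplitude L 1 M a) (ha' : IsPerronSectorGroundAmplitude L 1 M' a') (hMM' : |M| ≤ |M'|) :
    totalSpinSq a M ≤ totalSpinSq a' M' := by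
  obtain ⟨η₀, hη₀, hη⟩ := h L
  exact hη 1 (by linarith) le_rfl M M' a a' ha ha' hMM'

end NearFM

end Summit.HubbardSuperconductivity.HubbardSuperconductivity.Theorems.AnisotropyChord.Tower
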